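import Summits.ResolutionOfSingularities.ResolutionOfSingularities.Theorems.FrobeniusLadderFInjectiveMacaulayficationTwoRatioBPChartsCM
import Summits.ResolutionOfSingularities.ResolutionOfSingularities.Theorems.FrobeniusLadderFInjectiveMacaulayficationTwoRatioBPCIRow
import Summits.ResolutionOfSingularities.ResolutionOfSingularities.Theorems.FrobeniusLadderFInjectiveMacaulayficationDiagonalBPCIPointFloorLegal
import HarnessLib

/-!
# ★★★ ROW #13 / BED CI-3 TWO-SIDED — THE FLOOR LEGAL COLUMN and the assembly ⟨LEGAL, NOT FULL, CURED⟩ for `X = V(x₀²+x₁³+x₂⁵+x₃⁵+x₄⁷+x₅⁷, x₀²+2x₁³+x₂¹⁰+x₃¹⁰+x₄¹⁴+x₅¹⁴) ⊂ 𝔸⁶`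
# (crux `FInjectiveMacaulayfication` stmt-ResolutionOfSingularities-15315, chain w45a; res-L1-w45a-plan-1 RULING R24.2 (b) «(α′) GO and ONLY (α′) — ROW #13 TWO-SIDED … ⇒ `row13_CI3_pointFloor`»;
# seat res-L1-w45a-stub-2 g13; the CI-3 twin of ✓`DiagonalBPCIPointFloorLegal` + ✓`DiagonalBPCIRowTwoSided`)

[OURS · L1 W4.5a] Support file (`--supports stmt-ResolutionOfSingularities-15315 --as helper`); def-free; UNCONDITIONAL; no named fact, no sorry; a census row is a certificate on ONE bed
and nothing of the crux is proved; NOT a statement of any manuscript. AI-written (AI review weaker than expert review).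

* §1 `vertex_relations`, ★ `reesT_mem_radical` — `x̄₀² = G(x̄)`, `x̄₁³ = −H(x̄)` with `G, H ∈ (x₂, …, x₅)·𝔪`, so `(x̄₀t)², (x̄₁t)³ ∈ (x̄₂t, …, x̄₅t)`: the charts `D₊(x̄ⱼt)`, `j ≥ 2`, COVER `Bl_𝔪 X`;
* §2 `vertex_not_mem_regularLocus` (the vertex is not FULL — ✓`TwoRatioBPCIRow.twoRatioBP_vertex_not_full` — hence not regular), `regular_of_specializes` (`p ≥ 11`;
  ✓`TwoRatioDiagonalPair.isRegularLocalRing_off_vertex_twoRatio`);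
* §3 ★★★ `twoRatioBP_pointFloor_input_legal` (`p ≥ 11`): centre `≠ ⊥`, Sing-supported, `S′` regular off the closed fibre, CM AT EVERY STALK (✓`TwoRatioBPChartsCM` +
  ✓`PointFloorLegalCI.pointFloor_input_legal`);
* §4 ★★★ `row13_CI3_pointFloor` — ⟨LEGAL, NOT FULL, CURED⟩ (`p ≥ 11`, any field; `K := k̄` for the cure): ROW #13 is TWO-SIDED.
[cite: GortzWedhorn2020, Prop. 13.91 (2)] [cite: StacksProject, Tag 02OS and Tag 0804] [cite: Fedder1983, Thm. 1.12] [cite: IshiiSingularities2018, Thm. 4.4.23]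
-/

-- single-problem summit: the doubled namespace component is forced
set_option linter.dupNamespace false

noncomputable section

namespace Summit.ResolutionOfSingularities.ResolutionOfSingularities.Theorems.FInjectiveMacaulayfication.TwoRatioBPPointFloorLegal

open CategoryTheory AlgebraicGeometry TopologicalSpace IsLocalRing MvPolynomial
open Literature.AlgebraicGeometry.Resolution
open Summit.ResolutionOfSingularities.ResolutionOfSingularities.Theorems.FInjectiveMacaulayfication
open SliceableCentre GermOfGlobalBlowup

section Bed

variable (k : Type) [Field k]


/-! ## §1 ★ The charts `x₂, …, x₅` cover the blow-up -/

/-- The two relations at the vertex: `x̄₀² = Σ_{i≥2}(x̄ᵢ^{2aᵢ} − 2x̄ᵢ^{aᵢ})` (from `P = 2F₀ − F₁`) and `x̄₁³ = −Σ_{i≥2}(x̄ᵢ^{2aᵢ} − x̄ᵢ^{aᵢ})` (from `Q = F₁ − F₀`). [plumbing] -/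
theorem vertex_relations (F : Fin 2 → MvPolynomial (Fin 6) k)
    (hF0 : F 0 = X 0 ^ 2 + X 1 ^ 3 + X 2 ^ 5 + X 3 ^ 5 + X 4 ^ 7 + X 5 ^ 7)
    (hF1 : F 1 = X 0 ^ 2 + C 2 * X 1 ^ 3 + X 2 ^ 10 + X 3 ^ 10 + X 4 ^ 14 + X 5 ^ 14) :
    (Ideal.Quotient.mk (Ideal.span (Set.range F)) (X 0)) ^ 2 =
        (Ideal.Quotient.mk (Ideal.span (Set.range F)) (X 2) ^ 10 - 2 * Ideal.Quotient.mk (Ideal.span (Set.range F)) (X 2) ^ 5) +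
        (Ideal.Quotient.mk (Ideal.span (Set.range F)) (X 3) ^ 10 - 2 * Ideal.Quotient.mk (Ideal.span (Set.range F)) (X 3) ^ 5) +
        (Ideal.Quotient.mk (Ideal.span (Set.range F)) (X 4) ^ 14 - 2 * Ideal.Quotient.mk (Ideal.span (Set.range F)) (X 4) ^ 7) +
        (Ideal.Quotient.mk (Ideal.span (Set.range F)) (X 5) ^ 14 - 2 * Ideal.Quotient.mk (Ideal.span (Set.range F)) (X 5) ^ 7) ∧
      (Ideal.Quotient.mk (Ideal.span (Set.range F)) (X 1)) ^ 3 =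
        -((Ideal.Quotient.mk (Ideal.span (Set.range F)) (X 2) ^ 10 - Ideal.Quotient.mk (Ideal.span (Set.range F)) (X 2) ^ 5) +
          (Ideal.Quotient.mk (Ideal.span (Set.range F)) (X 3) ^ 10 - Ideal.Quotient.mk (Ideal.span (Set.range F)) (X 3) ^ 5) +
          (Ideal.Quotient.mk (Ideal.span (Set.range F)) (X 4) ^ 14 - Ideal.Quotient.mk (Ideal.span (Set.range F)) (X 4) ^ 7) +
          (Ideal.Quotient.mk (Ideal.span (Set.range F)) (X 5) ^ 14 - Ideal.Quotient.mk (Ideal.span (Set.range F)) (X 5) ^ 7)) := by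
  have hP := Ideal.Quotient.eq_zero_iff_mem.mpr (DiagonalBPCIChart5NotFull.PQ_mem k F 0)
  have hQ := Ideal.Quotient.eq_zero_iff_mem.mpr (DiagonalBPCIChart5NotFull.PQ_mem k F 1)
  simp only [Matrix.cons_val_zero, Matrix.cons_val_one, hF0, hF1, map_sub, map_add, map_mul, map_pow, map_ofNat] at hP hQ
  exact ⟨by linear_combination hP, by linear_combination hQ⟩

set_option maxHeartbeats 800000 in
-- two Rees-algebra identities checked in `R[t]`
/-- ★ **THE CHARTS `D₊(x̄₂t), …, D₊(x̄₅t)` COVER `Bl_𝔪 X`**: every `x̄ᵢt` lies in the radical of `(x̄₂t, x̄₃t, x̄₄t, x̄₅t)` in the Rees algebra `R[𝔪t]` (`(x̄₀t)²` and `(x̄₁t)³` are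
combinations of the `(x̄ⱼt)²`, `(x̄ⱼt)³`, `j ≥ 2`, by the vertex relations). [OURS · certificate; folklore] -/
theorem reesT_mem_radical (F : Fin 2 → MvPolynomial (Fin 6) k)
    (hF0 : F 0 = X 0 ^ 2 + X 1 ^ 3 + X 2 ^ 5 + X 3 ^ 5 + X 4 ^ 7 + X 5 ^ 7)
    (hF1 : F 1 = X 0 ^ 2 + C 2 * X 1 ^ 3 + X 2 ^ 10 + X 3 ^ 10 + X 4 ^ 14 + X 5 ^ 14) : ∀ i : Fin 6, Ideal.Quotient.mk (Ideal.span (Set.range F)) (X i) ≠ 0 →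
    reesT ((fun j : Fin 6 => Ideal.Quotient.mk (Ideal.span (Set.range F)) (X j)) i) (Ideal.subset_span (Set.mem_range_self i)) ∈
      (Ideal.span {z : reesAlgebra (Ideal.span (Set.range (fun j : Fin 6 => Ideal.Quotient.mk (Ideal.span (Set.range F)) (X j)))) |
        ∃ j : Fin 6, (j = 2 ∨ j = 3 ∨ j = 4 ∨ j = 5) ∧
          z = reesT ((fun j : Fin 6 => Ideal.Quotient.mk (Ideal.span (Set.range F)) (X j)) j) (Ideal.subset_span (Set.mem_range_self j))}).radical := by
  set R := MvPolynomial (Fin 6) k ⧸ Ideal.span (Set.range F) with hR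
  set x : Fin 6 → R := fun j => Ideal.Quotient.mk (Ideal.span (Set.range F)) (X j) with hx
  set T : Fin 6 → reesAlgebra (Ideal.span (Set.range x)) := fun i => reesT (x i) (Ideal.subset_span (Set.mem_range_self i)) with hT
  have hgen : ∀ j : Fin 6, (j = 2 ∨ j = 3 ∨ j = 4 ∨ j = 5) →
      T j ∈ Ideal.span {z : reesAlgebra (Ideal.span (Set.range x)) | ∃ j : Fin 6, (j = 2 ∨ j = 3 ∨ j = 4 ∨ j = 5) ∧ z = T j} :=
    fun j hj => Ideal.subset_span ⟨j, hj, rfl⟩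
  obtain ⟨hR0, hR1⟩ := vertex_relations k F hF0 hF1
  -- the two Rees-algebra identities, checked in `R[t]`
  have hC0 : (Polynomial.C (x 0)) ^ 2 =
      (Polynomial.C (x 2) ^ 10 - Polynomial.C 2 * Polynomial.C (x 2) ^ 5) + (Polynomial.C (x 3) ^ 10 - Polynomial.C 2 * Polynomial.C (x 3) ^ 5) +
      (Polynomial.C (x 4) ^ 14 - Polynomial.C 2 * Polynomial.C (x 4) ^ 7) + (Polynomial.C (x 5) ^ 14 - Polynomial.C 2 * Polynomial.C (x 5) ^ 7) := by
    have h := congrArg (Polynomial.C : R →+* Polynomial R) hR0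
    simpa only [map_add, map_sub, map_mul, map_pow] using h
  have hC1 : (Polynomial.C (x 1)) ^ 3 =
      -((Polynomial.C (x 2) ^ 10 - Polynomial.C (x 2) ^ 5) + (Polynomial.C (x 3) ^ 10 - Polynomial.C (x 3) ^ 5) +
        (Polynomial.C (x 4) ^ 14 - Polynomial.C (x 4) ^ 7) + (Polynomial.C (x 5) ^ 14 - Polynomial.C (x 5) ^ 7)) := by
    have h := congrArg (Polynomial.C : R →+* Polynomial R) hR1
    simpa only [map_add, map_sub, map_mul, map_pow, map_neg] using h
  have e0 : T 0 ^ 2 = algebraMap R _ (x 2 ^ 8 - 2 * x 2 ^ 3) * T 2 * T 2 + algebraMap R _ (x 3 ^ 8 - 2 * x 3 ^ 3) * T 3 * T 3 +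
      algebraMap R _ (x 4 ^ 12 - 2 * x 4 ^ 5) * T 4 * T 4 + algebraMap R _ (x 5 ^ 12 - 2 * x 5 ^ 5) * T 5 * T 5 := by
    apply Subtype.ext
    simp only [hT, Subalgebra.coe_pow, Subalgebra.coe_mul, Subalgebra.coe_add, Subalgebra.coe_algebraMap, coe_reesT, Polynomial.algebraMap_eq,
      ← Polynomial.C_mul_X_eq_monomial]
    simp only [map_mul, map_pow, map_sub]
    linear_combination (Polynomial.X : Polynomial R) ^ 2 * hC0
  have e1 : T 1 ^ 3 = -(algebraMap R _ (x 2 ^ 7 - x 2 ^ 2) * T 2 * T 2 * T 2 + algebraMap R _ (x 3 ^ 7 - x 3 ^ 2) * T 3 * T 3 * T 3 +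
      algebraMap R _ (x 4 ^ 11 - x 4 ^ 4) * T 4 * T 4 * T 4 + algebraMap R _ (x 5 ^ 11 - x 5 ^ 4) * T 5 * T 5 * T 5) := by
    apply Subtype.ext
    simp only [hT, Subalgebra.coe_pow, Subalgebra.coe_mul, Subalgebra.coe_add, Subalgebra.coe_neg, Subalgebra.coe_algebraMap, coe_reesT, Polynomial.algebraMap_eq,
      ← Polynomial.C_mul_X_eq_monomial]
    simp only [map_pow, map_sub]
    linear_combination (Polynomial.X : Polynomial R) ^ 3 * hC1
  intro i _
  change T i ∈ _
  fin_cases i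
  · refine ⟨2, ?_⟩
    show T 0 ^ 2 ∈ _
    rw [e0]
    refine add_mem (add_mem (add_mem ?_ ?_) ?_) ?_
    · exact Ideal.mul_mem_left _ _ (hgen 2 (Or.inl rfl))
    · exact Ideal.mul_mem_left _ _ (hgen 3 (Or.inr (Or.inl rfl)))
    · exact Ideal.mul_mem_left _ _ (hgen 4 (Or.inr (Or.inr (Or.inl rfl))))
    · exact Ideal.mul_mem_left _ _ (hgen 5 (Or.inr (Or.inr (Or.inr rfl))))
  · refine ⟨3, ?_⟩
    show T 1 ^ 3 ∈ _
    rw [e1]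
    refine neg_mem (add_mem (add_mem (add_mem ?_ ?_) ?_) ?_)
    · exact Ideal.mul_mem_left _ _ (hgen 2 (Or.inl rfl))
    · exact Ideal.mul_mem_left _ _ (hgen 3 (Or.inr (Or.inl rfl)))
    · exact Ideal.mul_mem_left _ _ (hgen 4 (Or.inr (Or.inr (Or.inl rfl))))
    · exact Ideal.mul_mem_left _ _ (hgen 5 (Or.inr (Or.inr (Or.inr rfl))))
  · exact Ideal.le_radical (hgen 2 (Or.inl rfl))
  · exact Ideal.le_radical (hgen 3 (Or.inr (Or.inl rfl)))
  · exact Ideal.le_radical (hgen 4 (Or.inr (Or.inr (Or.inl rfl))))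
  · exact Ideal.le_radical (hgen 5 (Or.inr (Or.inr (Or.inr rfl))))

/-! ## §2 The vertex is singular; its proper generizations are regular -/

/-- **The vertex is NOT a regular point**: a regular local ring of characteristic `p` is FULL, `𝒪_{X,v}` is not (✓`TwoRatioBPCIRow.twoRatioBP_vertex_not_full`, every `p`).
[OURS · certificate] -/
theorem vertex_not_mem_regularLocus (F : Fin 2 → MvPolynomial (Fin 6) k)
    (hF0 : F 0 = X 0 ^ 2 + X 1 ^ 3 + X 2 ^ 5 + X 3 ^ 5 + X 4 ^ 7 + X 5 ^ 7)
    (hF1 : F 1 = X 0 ^ 2 + C 2 * X 1 ^ 3 + X 2 ^ 10 + X 3 ^ 10 + X 4 ^ 14 + X 5 ^ 14) (p : ℕ) [Fact p.Prime] [CharP k p]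
    (v : Spec (.of (MvPolynomial (Fin 6) k ⧸ Ideal.span (Set.range F))))
    (hvm : v.asIdeal = Ideal.span (Set.range fun j : Fin 6 => Ideal.Quotient.mk (Ideal.span (Set.range F)) (X j))) :
    v ∉ Scheme.regularLocus (Spec (.of (MvPolynomial (Fin 6) k ⧸ Ideal.span (Set.range F)))) := by
  intro hreg
  haveI : IsRegularLocalRing ((Spec (.of (MvPolynomial (Fin 6) k ⧸ Ideal.span (Set.range F)))).presheaf.stalk v) := hreg
  haveI : CharP ((Spec (.of (MvPolynomial (Fin 6) k ⧸ Ideal.span (Set.range F)))).presheaf.stalk v) p :=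
    FTemkinClosedPoints.charP_stalk_of_over p (Spec.map (CommRingCat.ofHom (algebraMap k (MvPolynomial (Fin 6) k ⧸ Ideal.span (Set.range F)))))
      (𝟙 (Spec (.of (MvPolynomial (Fin 6) k ⧸ Ideal.span (Set.range F))))) v
  exact TwoRatioBPCIRow.twoRatioBP_vertex_not_full p k F hF0 hF1 v hvm (FTemkinClosedPoints.fullCl_of_isRegularLocalRing p _)

/-- **Every proper generization of the vertex is a regular point** (`p ≥ 11`: ✓`TwoRatioDiagonalPair.isRegularLocalRing_off_vertex_twoRatio` with the numerical data of
✓`TwoRatioBPCIRow`). [OURS · certificate; cite: Matsumura1987, Thm. 14.2] -/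
theorem regular_of_specializes (F : Fin 2 → MvPolynomial (Fin 6) k)
    (hF0 : F 0 = X 0 ^ 2 + X 1 ^ 3 + X 2 ^ 5 + X 3 ^ 5 + X 4 ^ 7 + X 5 ^ 7)
    (hF1 : F 1 = X 0 ^ 2 + C 2 * X 1 ^ 3 + X 2 ^ 10 + X 3 ^ 10 + X 4 ^ 14 + X 5 ^ 14) (p : ℕ) [Fact p.Prime] (hp : 11 ≤ p) [CharP k p]
    (v : Spec (.of (MvPolynomial (Fin 6) k ⧸ Ideal.span (Set.range F))))
    (hvm : v.asIdeal = Ideal.span (Set.range fun j : Fin 6 => Ideal.Quotient.mk (Ideal.span (Set.range F)) (X j))) :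
    ∀ y : Spec (.of (MvPolynomial (Fin 6) k ⧸ Ideal.span (Set.range F))), y ⤳ v → y ≠ v →
      y ∈ Scheme.regularLocus (Spec (.of (MvPolynomial (Fin 6) k ⧸ Ideal.span (Set.range F)))) := by
  classical
  obtain ⟨hak, hdk, h2k⟩ := TwoRatioBPCIRow.casts k p hp
  obtain ⟨hF0', hF1'⟩ := TwoRatioBPCIRow.F_eq_sum k F hF0 hF1
  obtain ⟨hbP, hbQ⟩ := TwoRatioBPCIRow.ratios
  obtain ⟨hminork, hsumk⟩ := TwoRatioBPCIRow.numerics k p hp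
  intro y hyv hne
  refine FermatCubicConeGerm.mem_regularLocus_Spec_of_isRegularLocalRing _
    (TwoRatioDiagonalPair.isRegularLocalRing_off_vertex_twoRatio p _ _ _ hbP hbQ (fun i => (hak i).2.1) (fun i => (hak i).2.2) h2k _ _ (fun _ => one_ne_zero) hdk
      hminork hsumk F hF0' hF1' y.asIdeal fun hle => hne ?_)
  have h2 : y.asIdeal ≤ v.asIdeal := (PrimeSpectrum.le_iff_specializes y v).mpr hyv
  exact PrimeSpectrum.ext (le_antisymm h2 (hvm ▸ hle))

end Bed

/-! ## §3 ★★★ The floor LEGAL column of ROW #13 -/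

/-- ★★★ **BED CI-3, FLOOR LEGAL COLUMN** (`char k = p ≥ 11`, `k` ANY field): for EVERY blowing up `g : S′ → Spec 𝒪_{X,v}` along the point floor: (i) the centre is `≠ ⊥`; (ii) its support lies
in `(Reg Spec 𝒪_{X,v})ᶜ`; (iii) `S′` is regular off the closed fibre; (iv) `S′` is COHEN–MACAULAY AT EVERY STALK — the CM input being the four monic-tower Rees charts `D₊(x̄₂t), …, D₊(x̄₅t)`
(✓`TwoRatioBPChartsCM`), which cover `Bl_𝔪 X` (`reesT_mem_radical`). ONE application of ✓`PointFloorLegalCI.pointFloor_input_legal`. [OURS · census certificate (floor LEGAL side of ROW #13);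
cite: GortzWedhorn2020, Prop. 13.91 (2); StacksProject, Tag 02OS and Tag 0804] -/
theorem twoRatioBP_pointFloor_input_legal (p : ℕ) [Fact p.Prime] (hp : 11 ≤ p) (k : Type) [Field k] [CharP k p]
    (F : Fin 2 → MvPolynomial (Fin 6) k)
    (hF0 : F 0 = X 0 ^ 2 + X 1 ^ 3 + X 2 ^ 5 + X 3 ^ 5 + X 4 ^ 7 + X 5 ^ 7)
    (hF1 : F 1 = X 0 ^ 2 + C 2 * X 1 ^ 3 + X 2 ^ 10 + X 3 ^ 10 + X 4 ^ 14 + X 5 ^ 14)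
    (v : Spec (.of (MvPolynomial (Fin 6) k ⧸ Ideal.span (Set.range F))))
    (hvm : v.asIdeal = Ideal.span (Set.range fun j : Fin 6 => Ideal.Quotient.mk (Ideal.span (Set.range F)) (X j)))
    (S' : Scheme.{0}) (g' : S' ⟶ Spec ((Spec (.of (MvPolynomial (Fin 6) k ⧸ Ideal.span (Set.range F)))).presheaf.stalk v))
    (hg' : IsBlowup g' ((affineBlowup.idealSheaf (Ideal.span (Set.range fun j : Fin 6 => Ideal.Quotient.mk (Ideal.span (Set.range F)) (X j)))).comap
      ((Spec (.of (MvPolynomial (Fin 6) k ⧸ Ideal.span (Set.range F)))).fromSpecStalk v))) :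
    ((affineBlowup.idealSheaf (Ideal.span (Set.range fun j : Fin 6 => Ideal.Quotient.mk (Ideal.span (Set.range F)) (X j)))).comap
        ((Spec (.of (MvPolynomial (Fin 6) k ⧸ Ideal.span (Set.range F)))).fromSpecStalk v)) ≠ ⊥ ∧
      (((((affineBlowup.idealSheaf (Ideal.span (Set.range fun j : Fin 6 => Ideal.Quotient.mk (Ideal.span (Set.range F)) (X j)))).comap
        ((Spec (.of (MvPolynomial (Fin 6) k ⧸ Ideal.span (Set.range F)))).fromSpecStalk v))).support :
          Set (Spec ((Spec (.of (MvPolynomial (Fin 6) k ⧸ Ideal.span (Set.range F)))).presheaf.stalk v))) ⊆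
        (Scheme.regularLocus (Spec ((Spec (.of (MvPolynomial (Fin 6) k ⧸ Ideal.span (Set.range F)))).presheaf.stalk v)))ᶜ) ∧
      (∀ s : S', g'.base s ≠ closedPoint ((Spec (.of (MvPolynomial (Fin 6) k ⧸ Ideal.span (Set.range F)))).presheaf.stalk v) → s ∈ Scheme.regularLocus S') ∧
      (∀ s : S', CMCl (S'.presheaf.stalk s)) := by
  obtain ⟨hak, -, h2⟩ := TwoRatioBPCIRow.casts k p hp
  obtain ⟨hF0', hF1'⟩ := TwoRatioBPCIRow.F_eq_sum k F hF0 hF1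
  obtain ⟨hbP, hbQ⟩ := TwoRatioBPCIRow.ratios
  haveI hI : (Ideal.span (Set.range F)).IsPrime := TwoRatioBPCIRow.isPrime_span k h2 F hF0 hF1
  have hX0 : (X 0 : MvPolynomial (Fin 6) k) ∉ Ideal.span (Set.range F) := fun h =>
    DiagonalPairTruncations.mk_X_ne_zero_pair_general _ _ (fun i => (hak i).2.1) (fun i => le_trans (hak i).2.1 (TwoRatioDiagonalPair.le_b _ _ _ hbP hbQ i)) _ _ F hF0' hF1' 0
      (Ideal.Quotient.eq_zero_iff_mem.mpr h)
  exact PointFloorLegalCI.pointFloor_input_legal k (Ideal.span (Set.range F)) 0 hX0 (fun j : Fin 6 => j = 2 ∨ j = 3 ∨ j = 4 ∨ j = 5)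
    (reesT_mem_radical k F hF0 hF1) (fun j hj q _ => by
      rcases hj with rfl | rfl | rfl | rfl
      · exact TwoRatioBPChartsCM.cmCl_reesChart_two k F hF0 hF1 h2 q
      · exact TwoRatioBPChartsCM.cmCl_reesChart_three k F hF0 hF1 h2 q
      · exact TwoRatioBPChartsCM.cmCl_reesChart_four k F hF0 hF1 h2 q
      · exact TwoRatioBPChartsCM.cmCl_reesChart_five k F hF0 hF1 h2 q)
    v hvm (vertex_not_mem_regularLocus k F hF0 hF1 p v hvm) (regular_of_specializes k F hF0 hF1 p hp v hvm) S' g' hg'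

/-! ## §4 ★★★ ROW #13 TWO-SIDED -/

/-- ★★★ **ROW #13 = BED CI-3 (the two-ratio, UNEQUAL-SUPPORT diagonal CI pair in `𝔸⁶`), TWO-SIDED, `p ≥ 11`, ANY FIELD: LEGAL ∧ NOT FULL ∧ CURED at the point floor.** The three conjuncts:
`twoRatioBP_pointFloor_input_legal` (§3), ✓`TwoRatioBPChart5NotFull.twoRatioBP_pointFloor_not_full` (CI Fedder necessity at the `x₅`-chart origin, p-uniform),
✓`TwoRatioBPCIRow.twoRatioBP_pointFloorCured` (the product-trick CI class theorem, read in `AlgebraicClosure k`). [OURS · assembly of landed theorems] -/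
theorem row13_CI3_pointFloor (p : ℕ) [Fact p.Prime] (hp : 11 ≤ p) (k : Type) [Field k] [CharP k p]
    (F : Fin 2 → MvPolynomial (Fin 6) k)
    (hF0 : F 0 = X 0 ^ 2 + X 1 ^ 3 + X 2 ^ 5 + X 3 ^ 5 + X 4 ^ 7 + X 5 ^ 7)
    (hF1 : F 1 = X 0 ^ 2 + C 2 * X 1 ^ 3 + X 2 ^ 10 + X 3 ^ 10 + X 4 ^ 14 + X 5 ^ 14)
    (v : Spec (.of (MvPolynomial (Fin 6) k ⧸ Ideal.span (Set.range F))))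
    (hvm : v.asIdeal = Ideal.span (Set.range fun j : Fin 6 => Ideal.Quotient.mk (Ideal.span (Set.range F)) (X j)))
    (S' : Scheme.{0}) (g' : S' ⟶ Spec ((Spec (.of (MvPolynomial (Fin 6) k ⧸ Ideal.span (Set.range F)))).presheaf.stalk v))
    (hg' : IsBlowup g' ((affineBlowup.idealSheaf (Ideal.span (Set.range fun j : Fin 6 => Ideal.Quotient.mk (Ideal.span (Set.range F)) (X j)))).comap
      ((Spec (.of (MvPolynomial (Fin 6) k ⧸ Ideal.span (Set.range F)))).fromSpecStalk v))) :
    (((affineBlowup.idealSheaf (Ideal.span (Set.range fun j : Fin 6 => Ideal.Quotient.mk (Ideal.span (Set.range F)) (X j)))).comap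
        ((Spec (.of (MvPolynomial (Fin 6) k ⧸ Ideal.span (Set.range F)))).fromSpecStalk v)) ≠ ⊥ ∧
      (((((affineBlowup.idealSheaf (Ideal.span (Set.range fun j : Fin 6 => Ideal.Quotient.mk (Ideal.span (Set.range F)) (X j)))).comap
        ((Spec (.of (MvPolynomial (Fin 6) k ⧸ Ideal.span (Set.range F)))).fromSpecStalk v))).support :
          Set (Spec ((Spec (.of (MvPolynomial (Fin 6) k ⧸ Ideal.span (Set.range F)))).presheaf.stalk v))) ⊆
        (Scheme.regularLocus (Spec ((Spec (.of (MvPolynomial (Fin 6) k ⧸ Ideal.span (Set.range F)))).presheaf.stalk v)))ᶜ) ∧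
      (∀ s : S', g'.base s ≠ closedPoint ((Spec (.of (MvPolynomial (Fin 6) k ⧸ Ideal.span (Set.range F)))).presheaf.stalk v) → s ∈ Scheme.regularLocus S') ∧
      (∀ s : S', CMCl (S'.presheaf.stalk s))) ∧
    (∃ s : S', g'.base s = closedPoint ((Spec (.of (MvPolynomial (Fin 6) k ⧸ Ideal.span (Set.range F)))).presheaf.stalk v) ∧ ¬ FullCl p (S'.presheaf.stalk s)) ∧
    (∃ 𝓚 : S'.IdealSheafData, 𝓚 ≠ ⊥ ∧
      (∀ s ∈ (𝓚.support : Set S'), g'.base s = closedPoint ((Spec (.of (MvPolynomial (Fin 6) k ⧸ Ideal.span (Set.range F)))).presheaf.stalk v)) ∧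
      ∀ (S'' : Scheme.{0}) (π : S'' ⟶ S'), IsBlowup π 𝓚 → ∀ s : S'', FullCl p (S''.presheaf.stalk s)) := by
  have h2 : (2 : k) ≠ 0 := by exact_mod_cast DiagonalBPCIRow.natCast_ne_zero_of_lt (R := k) p 2 (by norm_num) (by omega)
  exact ⟨twoRatioBP_pointFloor_input_legal p hp k F hF0 hF1 v hvm S' g' hg',
    TwoRatioBPChart5NotFull.twoRatioBP_pointFloor_not_full p k h2 F hF0 hF1 v hvm S' g' hg',
    TwoRatioBPCIRow.twoRatioBP_pointFloorCured p hp k (AlgebraicClosure k) F hF0 hF1 v hvm S' g' hg'⟩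

end Summit.ResolutionOfSingularities.ResolutionOfSingularities.Theorems.FInjectiveMacaulayfication.TwoRatioBPPointFloorLegal

end
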